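import Literature.Computability.Cryptography.CsidhActionKernelsProofs
import HarnessLib

/-!
# The CSIDH class-group action: the `ℤ[√-p]`-action on `E_A(𝔽̄_p)` and the torsion `E_A[𝔞]`

Definition file (D-0017 topic `Computability/Cryptography`) supporting the proof of the named fact
`csidh_classGroupAction` of `Literature.Computability.Cryptography.CsidhAction`
(Castryck–Lange–Martindale–Panny–Renes, *CSIDH*, ASIACRYPT 2018, §3): the dictionary
`ℤ[π] ≅ ℤ[√-p]`, `√-p ↦ π` (the Frobenius), through which an ideal `𝔞 ⊆ ℤ[√-p]` acts on the
geometric points of a Montgomery curve `E_A / 𝔽_p` and defines the finite subgroup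
`E_A[𝔞] = ⋂_{α ∈ 𝔞} ker α` of CSIDH §3 ("the separable part of `φ_𝔞` has kernel
`∩_{α∈𝔞} ker α`"). Two definitions with bodies and their API:

* `zact p A z : E_A(𝔽̄_p) →+ E_A(𝔽̄_p)`, the action of `z = m + n√-p ∈ ℤ√(-p)`:
  `z · T = mT + n πT` (defined for every `A`; it is a *ring* action — `zact_mul` — exactly when
  `π² = -p`, i.e. for valid `A`, `frob_smul_frob_smul`);
* `idealTorsion p A I`, the subgroup `E_A[I] = {T | ∀ z ∈ I, z · T = O}` of an ideal
  `I ⊆ ℤ√(-p)`; `idealKernel_eq_idealTorsion`: the file's `idealKernel p f A` (defined by the two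
  generators `a`, `-b/2 + √-p` of `𝔞_f`) *is* `E_A[𝔞_f]` for the ideal
  `𝔞_f = ideal (-p) f = (a, -b/2 + √-p)` of `ZsqrtdFormClassGroup.lean`;
* the kernel calculus used for the compatibility of the action with ideal multiplication:
  `idealTorsion_span_singleton_mul` (`E[(x)I] = x⁻¹ E[I]`), `idealTorsion_mono`,
  `Isogeny.map_zact` (an `𝔽_p`-isogeny between valid curves commutes with the action) and
  `comap_idealTorsion_eq_idealTorsion_mul` (`g⁻¹(E'[I]) = E[I · J]` when `ker g = E[J]`).

## References

* [CastryckEtAl2018] W. Castryck, T. Lange, C. Martindale, L. Panny, J. Renes, *CSIDH*,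
  ASIACRYPT 2018, §3 (the class-group action: `E[𝔞]`, `φ_𝔞`, "Multiplication of ideals
  corresponds to the composition of isogenies"), §4 (`π² = -p`).
* [Cox2013] D. A. Cox, *Primes of the form x² + ny²*, 2nd ed., Thm. 7.7 (`𝔞_f = [a, (-b+√D)/2]`).
* W. C. Waterhouse, *Abelian varieties over finite fields*, Ann. Sci. ÉNS 2 (1969), §3
  (kernel ideals `H(𝔞) = ∩ ker α`).

## Design

Real definitions (`def` with bodies, `[cite]`d), `noncomputable section`, `open scoped Classical`;
the ring-action identities carry the validity hypotheses `p ≡ 3 (mod 8)`, `IsCoeff p A` under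
which `π² = -p` holds. No named facts.
-/

noncomputable section

open scoped Classical

namespace Literature.Computability.Cryptography.Csidh

open Literature.NumberTheory.QuadraticFields.Quadratic
open Literature.NumberTheory.QuadraticFields.Quadratic.BinQF
open WeierstrassCurve

variable (p : ℕ) [Fact p.Prime]

/-! ### The action of `ℤ[√-p]` on `E_A(𝔽̄_p)` -/

/-- **The action of `z = m + n√-p ∈ ℤ[√-p] ≅ ℤ[π]` on `E_A(𝔽̄_p)`**: `z · T = mT + n π(T)`, `π` the
`p`-power Frobenius (`frob p`). CSIDH §3–4 (`End_p(E) ⊇ ℤ[π]`, `π ↦ √-p`).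
[cite: CastryckEtAl2018, §3 (class-group action) and §4] -/
def zact (A : ZMod p) (z : ℤ√(-(p : ℤ))) : (curve p A).geomPoints →+ (curve p A).geomPoints :=
  z.re • AddMonoidHom.id _ + z.im • DistribSMul.toAddMonoidHom (curve p A).geomPoints (frob p)

variable {p}

/-- `z · T = (re z) T + (im z) πT`. [folklore] -/
@[simp]
theorem zact_apply (A : ZMod p) (z : ℤ√(-(p : ℤ))) (T : (curve p A).geomPoints) :
    zact p A z T = z.re • T + z.im • (frob p • T) :=
  rfl

/-- The action is additive in `z`. [folklore] -/
theorem zact_add (A : ZMod p) (z w : ℤ√(-(p : ℤ))) (T : (curve p A).geomPoints) :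
    zact p A (z + w) T = zact p A z T + zact p A w T := by
  simp only [zact_apply, Zsqrtd.re_add, Zsqrtd.im_add, add_smul]
  abel

/-- `0 · T = O`. [folklore] -/
theorem zact_zero (A : ZMod p) (T : (curve p A).geomPoints) : zact p A 0 T = 0 := by
  simp

/-- `1 · T = T`. [folklore] -/
theorem zact_one (A : ZMod p) (T : (curve p A).geomPoints) : zact p A 1 T = T := by
  simp

/-- An integer `m ∈ ℤ ⊆ ℤ[√-p]` acts as `[m]`. [folklore] -/
theorem zact_intCast (A : ZMod p) (m : ℤ) (T : (curve p A).geomPoints) :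
    zact p A (m : ℤ√(-(p : ℤ))) T = m • T := by
  simp

/-- `√-p` acts as the Frobenius `π`. [cite: CastryckEtAl2018, §4 (`π² = -p`)] -/
theorem zact_sqrtd (A : ZMod p) (T : (curve p A).geomPoints) :
    zact p A Zsqrtd.sqrtd T = frob p • T := by
  simp [Zsqrtd.sqrtd]

/-- The generator `-b/2 + √-p` of `𝔞_f` acts by `T ↦ -(b/2)T + πT`. [folklore] -/
theorem zact_gen (A : ZMod p) (b : ℤ) (T : (curve p A).geomPoints) :
    zact p A ⟨-(b / 2), 1⟩ T = (-(b / 2)) • T + frob p • T := by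
  simp

/-- **Multiplicativity**: for a valid `A` (`π² = -p`), `(zw) · T = z · (w · T)`. [cite: CastryckEtAl2018, §4 (`π² = -p`)] -/
theorem zact_mul (hp8 : p % 8 = 3) {A : ZMod p} (hA : IsCoeff p A) (z w : ℤ√(-(p : ℤ)))
    (T : (curve p A).geomPoints) : zact p A (z * w) T = zact p A z (zact p A w T) := by
  simp only [zact_apply, Zsqrtd.re_mul, Zsqrtd.im_mul, smul_add, frob_smul_zsmul,
    frob_smul_frob_smul hp8 hA, smul_smul]
  generalize frob p • T = X
  module

/-- The action is commutative: `z · (w · T) = w · (z · T)`. [folklore] -/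
theorem zact_comm (hp8 : p % 8 = 3) {A : ZMod p} (hA : IsCoeff p A) (z w : ℤ√(-(p : ℤ)))
    (T : (curve p A).geomPoints) : zact p A z (zact p A w T) = zact p A w (zact p A z T) := by
  rw [← zact_mul hp8 hA, ← zact_mul hp8 hA, mul_comm]

/-- The action commutes with `Γ_{𝔽_p}` (Frobenius is central). [folklore] -/
theorem smul_zact (A : ZMod p) (σ : Field.absoluteGaloisGroup (ZMod p)) (z : ℤ√(-(p : ℤ)))
    (T : (curve p A).geomPoints) : σ • zact p A z T = zact p A z (σ • T) := by
  simp only [zact_apply, smul_add, smul_comm σ, ← mul_smul, frob_mul_comm p σ]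

/-! ### The torsion subgroup `E_A[I]` of an ideal -/

variable (p) in
/-- **`E_A[I] = ⋂_{z ∈ I} ker (z ·)`**, the points killed by every element of the ideal
`I ⊆ ℤ[√-p]` — CSIDH §3: the kernel `∩_{α ∈ 𝔞} ker α` of `φ_𝔞 : E → E/𝔞`; Waterhouse's `H(𝔞)`.
[cite: CastryckEtAl2018, §3 (class-group action)] -/
def idealTorsion (A : ZMod p) (I : Ideal (ℤ√(-(p : ℤ)))) : AddSubgroup (curve p A).geomPoints where
  carrier := {T | ∀ z ∈ I, zact p A z T = 0}
  zero_mem' z _ := map_zero _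
  add_mem' {T T'} hT hT' z hz := by rw [map_add, hT z hz, hT' z hz, add_zero]
  neg_mem' {T} hT z hz := by rw [map_neg, hT z hz, neg_zero]

/-- Membership in `E_A[I]`. [folklore] -/
theorem mem_idealTorsion_iff {A : ZMod p} {I : Ideal (ℤ√(-(p : ℤ)))} (T : (curve p A).geomPoints) :
    T ∈ idealTorsion p A I ↔ ∀ z ∈ I, zact p A z T = 0 :=
  Iff.rfl

/-- `E_A[I]` is antitone in `I`. [folklore] -/
theorem idealTorsion_mono {A : ZMod p} {I J : Ideal (ℤ√(-(p : ℤ)))} (h : I ≤ J) :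
    idealTorsion p A J ≤ idealTorsion p A I :=
  fun _ hT z hz ↦ hT z (h hz)

/-- **The annihilator of a point is an ideal** (valid `A`): if the generators of `I = (S)` kill
`T` then so does every element of `I`. [folklore] -/
theorem mem_idealTorsion_span_iff (hp8 : p % 8 = 3) {A : ZMod p} (hA : IsCoeff p A)
    (S : Set (ℤ√(-(p : ℤ)))) (T : (curve p A).geomPoints) :
    T ∈ idealTorsion p A (Ideal.span S) ↔ ∀ z ∈ S, zact p A z T = 0 := by
  refine ⟨fun h z hz ↦ h z (Ideal.subset_span hz), fun h z hz ↦ ?_⟩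
  induction hz using Submodule.span_induction with
  | mem z hz => exact h z hz
  | zero => exact zact_zero A T
  | add z w _ _ hz hw => rw [zact_add, hz, hw, add_zero]
  | smul r z _ hz => rw [smul_eq_mul, zact_mul hp8 hA, hz, map_zero]

/-- **`idealKernel p f A = E_A[𝔞_f]`** for the ideal `𝔞_f = (a, -b/2 + √-p)` of
`ZsqrtdFormClassGroup.lean` (valid `A`): the two generators kill `T` iff `aT = O` and
`πT = (b/2)T`. [cite: CastryckEtAl2018, §3 (class-group action)] [cite: Cox2013, §7.B Thm. 7.7] -/
theorem idealKernel_eq_idealTorsion (hp8 : p % 8 = 3) {A : ZMod p} (hA : IsCoeff p A) (f : BinQF) :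
    idealKernel p f A = idealTorsion p A (ideal (-(p : ℤ)) f) := by
  ext T
  rw [mem_idealKernel_iff, ideal, mem_idealTorsion_span_iff hp8 hA]
  simp only [Set.mem_insert_iff, Set.mem_singleton_iff, forall_eq_or_imp, forall_eq,
    zact_apply, Zsqrtd.re_intCast, Zsqrtd.im_intCast, zero_smul, add_zero, one_smul]
  refine and_congr Iff.rfl ?_
  rw [neg_smul, neg_add_eq_zero, eq_comm]

/-- **`E_A[(x) I] = x⁻¹ E_A[I]`**: `T` is killed by `xI` iff `x · T` is killed by `I` (valid `A`).
CSIDH §3 ("principal ideals correspond to endomorphisms"). [cite: CastryckEtAl2018, §3 (class-group action)] -/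
theorem idealTorsion_span_singleton_mul (hp8 : p % 8 = 3) {A : ZMod p} (hA : IsCoeff p A)
    (x : ℤ√(-(p : ℤ))) (I : Ideal (ℤ√(-(p : ℤ)))) :
    idealTorsion p A (Ideal.span {x} * I) = (idealTorsion p A I).comap (zact p A x) := by
  ext T
  rw [AddSubgroup.mem_comap, mem_idealTorsion_iff, mem_idealTorsion_iff]
  constructor
  · intro h z hz
    rw [← zact_mul hp8 hA, mul_comm]
    exact h _ (Ideal.mul_mem_mul (Ideal.mem_span_singleton_self x) hz)
  · intro h z hz
    refine Submodule.mul_induction_on hz (fun y hy w hw ↦ ?_) (fun z w hz hw ↦ ?_)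
    · obtain ⟨c, rfl⟩ := Ideal.mem_span_singleton'.mp hy
      rw [mul_assoc, zact_mul hp8 hA, mul_comm, zact_mul hp8 hA, h w hw, map_zero]
    · rw [zact_add, hz, hw, add_zero]

/-! ### Isogenies commute with the action -/

/-- **An `𝔽_p`-isogeny `E_A → E_{A'}` commutes with the `ℤ[√-p]`-action** (it is additive and
commutes with the Frobenius). [folklore] -/
theorem Isogeny.map_zact {A A' : ZMod p} (g : (curve p A).Isogeny (curve p A')) (z : ℤ√(-(p : ℤ)))
    (T : (curve p A).geomPoints) : g (zact p A z T) = zact p A' z (g T) := by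
  simp only [zact_apply, map_add, map_zsmul, Isogeny.map_smul]

/-- **`g⁻¹(E_{A'}[I]) = E_A[I · J]` when `ker g = E_A[J]`** (valid `A`): for an `𝔽_p`-isogeny
`g : E_A → E_{A'}` with kernel `E_A[J]`, a point `T` has `g T ∈ E_{A'}[I]` iff `T ∈ E_A[IJ]`
(`I · (g T) = g(I · T) = O` iff `I · T ⊆ E_A[J]`). This is "multiplication of ideals corresponds
to the composition of isogenies" (CSIDH §3) on kernels. [cite: CastryckEtAl2018, §3 (class-group action)] -/
theorem comap_idealTorsion_eq_idealTorsion_mul (hp8 : p % 8 = 3) {A A' : ZMod p} (hA : IsCoeff p A)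
    (g : (curve p A).Isogeny (curve p A')) {I J : Ideal (ℤ√(-(p : ℤ)))}
    (hker : g.toAddMonoidHom.ker = idealTorsion p A J) :
    (idealTorsion p A' I).comap g.toAddMonoidHom = idealTorsion p A (I * J) := by
  ext T
  rw [AddSubgroup.mem_comap, mem_idealTorsion_iff, mem_idealTorsion_iff]
  have hk : ∀ S : (curve p A).geomPoints, g S = 0 ↔ S ∈ idealTorsion p A J := fun S ↦ by
    rw [← hker, AddMonoidHom.mem_ker, Isogeny.coe_toAddMonoidHom]
  constructor
  · intro h z hz
    refine Submodule.mul_induction_on hz (fun i hi j hj ↦ ?_) (fun z w hz hw ↦ ?_)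
    · have : g (zact p A i T) = 0 := by
        rw [Isogeny.map_zact]
        exact h i hi
      rw [mul_comm, zact_mul hp8 hA]
      exact ((hk _).mp this) j hj
    · rw [zact_add, hz, hw, add_zero]
  · intro h i hi
    rw [Isogeny.coe_toAddMonoidHom, ← Isogeny.map_zact, hk, mem_idealTorsion_iff]
    intro j hj
    rw [← zact_mul hp8 hA, mul_comm]
    exact h _ (Ideal.mul_mem_mul hi hj)

end Literature.Computability.Cryptography.Csidh
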